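import Literature.Computability.Cryptography.NaorReingoldDDH
import Literature.Computability.Cryptography.InnerProductHash
import Literature.Computability.MetaComplexity.TruthTables
import HarnessLib

/-!
# The Naor–Reingold hybrids, truth-table form (towards Thm. 4.1 for non-uniform adversaries)

The bookkeeping behind the hybrid proof of Naor–Reingold's Theorem 4.1 (J. ACM 51 (2004),
pp. 250–251) in the NON-ADAPTIVE, truth-table setting of the natural-proofs application
(Razborov–Rudich 1997, §4; Arora–Barak 2009, §23.3): the distinguisher reads the whole `2ⁿ`-bit
table of the hashed function `x ↦ ⟨r, bin((g^{a₀})^{∏_{xᵢ=1} aᵢ})⟩`, so the `J`-th hybrid's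
"answers `(g^{b} or g^{c})^{∏_{k>J, x_k=1} a_k}`" (p. 250, step (3)) become explicit tables.

For parameters `pp : Params` (input length `n`, word length `m`, an instance `⟨P, Q, g⟩`) and the
sample space `HΩ pp = (Fin 2ⁿ → ℤ_Q) × (Fin (n+1) → ℤ_Q) × {0,1}^m ∋ (R, a, r)` (a random function
`R` on the cube, read through the tree's enumeration `boolFunEquivFin`; the key exponents; the
hash key):

* `mask j x` (the first `j` bits of `x`), `prodFrom j a x = ∏_{i ≥ j, xᵢ = 1} a_{i+1}`;
* the **level hybrids** `hybExp j R a x = R(mask j x) · prodFrom j a x` and their hashed tables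
  `hybTable` — level `0` is the Naor–Reingold function with key `(R(0ⁿ), a₁, …, aₙ)`
  (`hybExp_zero`), level `n` is the uniformly random function `R` (`hybExp_n`);
* the **sub-hybrids** `subExp j τ` between levels `j+1` (`τ = 0`, `subExp_zero`) and `j`
  (`τ = 2ⁿ`, `subExp_two_pow`): for the first `τ` prefixes `u` (in the enumeration) the value
  `R(u1)` is COUPLED as `R(u0) · a_{j+1}` (`couple`), i.e. the pair `(g^{R(u0)}, g^{R(u1)})` is a
  Diffie–Hellman pair with the common secret `a_{j+1}` instead of a random pair — one DDH
  challenge per step `τ → τ+1`;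
* the case analysis of one step (`subExp_succ_of_inactive`, `subExp_at_prefix_true/false`,
  `subExp_of_coupled`, `subExp_of_free`): consecutive sub-hybrids differ only at the inputs with
  prefix `u_τ`, where they read `R(u_τ 0) · a_{j+1}` versus `R(u_τ 1)`.

Pure algebra of exponents (in `ℕ`); probabilities and circuits are in
`NaorReingoldReduction.lean`.

## References

* M. Naor, O. Reingold, *Number-theoretic constructions of efficient pseudo-random functions*,
  J. ACM 51 (2004), Construction 4.1, Thm. 4.1 and its proof (pp. 245, 250–251).
* O. Goldreich, S. Goldwasser, S. Micali, *How to construct random functions*, J. ACM 33 (1986)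
  (the tree of hybrids).
* S. Arora, B. Barak, *Computational Complexity: A Modern Approach*, CUP 2009, §23.3.
-/

noncomputable section

namespace Literature.Computability.Cryptography

open Finset Literature.Computability.MetaComplexity

namespace NaorReingold

/-- The parameters of one security level: input length `n`, word length `m` (bits of group
elements and of the hash key), and an instance `⟨P, Q, g⟩` with `Q > 0`. [cite: NaorReingold2004, Construction 4.1 (p. 245)] -/
structure Params where
  /-- input length -/
  n : ℕ
  /-- word length -/
  m : ℕ
  /-- the modulus -/
  P : ℕ
  /-- the (prime) order of `g` -/
  Q : ℕ
  /-- the base -/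
  g : ℕ
  /-- `Q` is positive (so that `ℤ_Q = Fin Q` is nonempty) -/
  Q_pos : 0 < Q

namespace Params

variable (pp : Params)

/-- `Q ≠ 0`. [folklore] -/
instance : NeZero pp.Q := ⟨pp.Q_pos.ne'⟩

/-- `ℤ_Q` is nonempty. [folklore] -/
instance : Nonempty (Fin pp.Q) := ⟨⟨0, pp.Q_pos⟩⟩

/-- The enumeration of the cube `{0,1}ⁿ` by `Fin 2ⁿ` used by truth tables (`boolFunEquivFin`). [folklore] -/
abbrev idx : (Fin pp.n → Bool) ≃ Fin (2 ^ pp.n) := boolFunEquivFin pp.n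

/-- `g^v ∈ ℤ_P`. [cite: NaorReingold2004, §3.2 (p. 242)] -/
def gpow (v : ℕ) : ZMod pp.P := (pp.g : ZMod pp.P) ^ v

/-- The `m` low bits of the canonical representative of a residue (the bit string handed to
adversaries, as in `ddhEncode`). [cite: NaorReingold2004, Assumption 3.1 (p. 243)] -/
def bits (u : ZMod pp.P) : Fin pp.m → Bool := fun l => u.val.testBit l

/-- The hashed bit `⟨r, bin(u)⟩ mod 2` of a group element (Construction 4.2 with the
inner-product family). [cite: NaorReingold2004, Construction 4.2 (p. 246)] -/
def hashBit (r : Fin pp.m → Bool) (u : ZMod pp.P) : Bool := innerBit r (pp.bits u)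

/-! ### Prefixes and partial products -/

/-- The first `j` bits of `x` (the others zeroed): the argument of the random function at level
`j` of the hybrid. [cite: NaorReingold2004, proof of Thm. 4.1 (p. 250)] -/
def mask (j : ℕ) (x : Fin pp.n → Bool) : Fin pp.n → Bool := fun i => x i && decide (i.val < j)

/-- The partial subset product `∏_{i ≥ j, xᵢ = 1} a_{i+1}` over the LAST `n - j` input bits
("`∏_{k > J, x_k = 1} a_k`", p. 250, with 0-based bits). [cite: NaorReingold2004, proof of Thm. 4.1 (p. 250, step (3))] -/
def prodFrom (j : ℕ) (a : Fin (pp.n + 1) → ℕ) (x : Fin pp.n → Bool) : ℕ :=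
  ∏ i : Fin pp.n, if j ≤ i.val ∧ x i = true then a i.succ else 1

variable {pp}

/-- Unfolding of `mask`. [folklore] -/
theorem mask_apply (j : ℕ) (x : Fin pp.n → Bool) (i : Fin pp.n) :
    pp.mask j x i = (x i && decide (i.val < j)) := rfl

/-- Level `0` reads the random function at the single point `0ⁿ`. [folklore] -/
theorem mask_zero (x : Fin pp.n → Bool) : pp.mask 0 x = fun _ => false := by
  funext i; simp [mask_apply]

/-- Level `n` reads the random function at `x` itself. [folklore] -/
theorem mask_n (x : Fin pp.n → Bool) : pp.mask pp.n x = x := by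
  funext i; simp [mask_apply, i.isLt]

/-- Masking is idempotent / nested: `mask j ∘ mask k = mask j` for `j ≤ k`. [folklore] -/
theorem mask_mask {j k : ℕ} (h : j ≤ k) (x : Fin pp.n → Bool) : pp.mask j (pp.mask k x) = pp.mask j x := by
  funext i
  simp only [mask, Bool.and_assoc]
  by_cases hi : i.val < j
  · simp [hi, lt_of_lt_of_le hi h]
  · simp [hi]

/-- A string in the image of `mask j` is fixed by it. [folklore] -/
theorem mask_eq_self_of_eq {j : ℕ} {x u : Fin pp.n → Bool} (h : pp.mask j x = u) : pp.mask j u = u := by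
  rw [← h, mask_mask le_rfl]

/-- Bit `j` of `mask (j+1) x` is `x_j`. [folklore] -/
theorem mask_succ_apply_self (j : Fin pp.n) (x : Fin pp.n → Bool) : pp.mask (j.val + 1) x j = x j := by
  simp [mask]

/-- Bit `j` of `mask j x` is `0`. [folklore] -/
theorem mask_apply_self (j : Fin pp.n) (x : Fin pp.n → Bool) : pp.mask j.val x j = false := by
  simp [mask]

/-- If `x_j = 0` the prefixes of lengths `j` and `j + 1` agree. [folklore] -/
theorem mask_succ_of_false {j : Fin pp.n} {x : Fin pp.n → Bool} (hx : x j = false) :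
    pp.mask (j.val + 1) x = pp.mask j.val x := by
  funext i
  simp only [mask]
  by_cases hi : i = j
  · subst hi; simp [hx]
  · have : i.val ≠ j.val := fun h => hi (Fin.ext h)
    have hiff : i.val < j.val + 1 ↔ i.val < j.val := by omega
    simp [hiff]

/-- Clearing bit `j` of the length-`(j+1)` prefix gives the length-`j` prefix. [folklore] -/
theorem update_mask_succ_false (j : Fin pp.n) (x : Fin pp.n → Bool) :
    Function.update (pp.mask (j.val + 1) x) j false = pp.mask j.val x := by
  funext i
  by_cases hi : i = j
  · subst hi; simp [mask]
  · rw [Function.update_of_ne hi]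
    have : i.val ≠ j.val := fun h => hi (Fin.ext h)
    have hiff : i.val < j.val + 1 ↔ i.val < j.val := by omega
    simp [mask, hiff]

/-- Setting bit `j` of the length-`j` prefix gives the length-`(j+1)` prefix when `x_j = 1`. [folklore] -/
theorem update_mask_true {j : Fin pp.n} {x : Fin pp.n → Bool} (hx : x j = true) :
    Function.update (pp.mask j.val x) j true = pp.mask (j.val + 1) x := by
  rw [← update_mask_succ_false j x, Function.update_idem]
  exact Function.update_eq_self_iff.2 (by rw [mask_succ_apply_self, hx])

/-- The mask of a string has bit `j` and all later bits equal to `0`; in particular a fixed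
point `u = mask j u` has `u_j = 0`. [folklore] -/
theorem apply_self_of_mask_eq {j : Fin pp.n} {u : Fin pp.n → Bool} (h : pp.mask j.val u = u) : u j = false := by
  rw [← h]; exact mask_apply_self j u

/-- No partial product is left at level `n`. [folklore] -/
theorem prodFrom_n (a : Fin (pp.n + 1) → ℕ) (x : Fin pp.n → Bool) : pp.prodFrom pp.n a x = 1 := by
  unfold prodFrom
  refine Finset.prod_eq_one fun i _ => ?_
  simp [Nat.not_le.2 i.isLt]

/-- At level `0` the partial product is the full subset product of Construction 4.1. [cite: NaorReingold2004, Construction 4.1 (p. 245)] -/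
theorem prodFrom_zero (a : Fin (pp.n + 1) → ℕ) (x : Fin pp.n → Bool) :
    pp.prodFrom 0 a x = ∏ i : Fin pp.n, if x i then a i.succ else 1 := by
  unfold prodFrom
  refine Finset.prod_congr rfl fun i _ => ?_
  simp

/-- Peeling off the factor of bit `j`: `prodFrom j = a_{j+1}^{x_j} · prodFrom (j+1)`. [folklore] -/
theorem prodFrom_eq_mul_succ (j : Fin pp.n) (a : Fin (pp.n + 1) → ℕ) (x : Fin pp.n → Bool) :
    pp.prodFrom j.val a x = (if x j = true then a j.succ else 1) * pp.prodFrom (j.val + 1) a x := by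
  unfold prodFrom
  rw [← Finset.mul_prod_erase _ _ (Finset.mem_univ j), ← Finset.mul_prod_erase univ _ (Finset.mem_univ j)]
  have h1 : (if j.val + 1 ≤ j.val ∧ x j = true then a j.succ else 1) = 1 := by simp
  rw [h1, one_mul]
  congr 1
  · simp
  · refine Finset.prod_congr rfl fun i hi => ?_
    have hij : i ≠ j := Finset.ne_of_mem_erase hi
    have hv : i.val ≠ j.val := fun h => hij (Fin.ext h)
    have hiff : j.val ≤ i.val ↔ j.val + 1 ≤ i.val := by omega
    simp [hiff]

/-- The partial products only read key entries `a_{i+1}` with `i ≥ j`. [folklore] -/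
theorem prodFrom_congr {j : ℕ} {a a' : Fin (pp.n + 1) → ℕ} (x : Fin pp.n → Bool)
    (h : ∀ i : Fin pp.n, j ≤ i.val → a i.succ = a' i.succ) : pp.prodFrom j a x = pp.prodFrom j a' x := by
  unfold prodFrom
  refine Finset.prod_congr rfl fun i _ => ?_
  by_cases hi : j ≤ i.val
  · simp [hi, h i hi]
  · simp [hi]

/-! ### The level hybrids -/

variable (pp)

/-- The sample space of the hybrids: a random function `R : {0,1}ⁿ → ℤ_Q` (indexed through the
enumeration of the cube), key exponents `a ∈ ℤ_Q^{n+1}` (entry `a₀` unused), and the hash key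
`r ∈ {0,1}^m`. [cite: NaorReingold2004, proof of Thm. 4.1 (p. 250)] -/
abbrev HΩ : Type := (Fin (2 ^ pp.n) → Fin pp.Q) × (Fin (pp.n + 1) → Fin pp.Q) × (Fin pp.m → Bool)

/-- Key exponents as natural numbers. [folklore] -/
def natKey (a : Fin (pp.n + 1) → Fin pp.Q) : Fin (pp.n + 1) → ℕ := fun i => (a i).val

/-- The exponent of the `j`-th hybrid function at `x`: `R(x₁…x_j 0…0) · ∏_{i ≥ j, xᵢ=1} a_{i+1}`
(NR p. 250: the first `J` bits select an independent value, the remaining bits act as in the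
construction). [cite: NaorReingold2004, proof of Thm. 4.1 (p. 250)] -/
def hybExp (j : ℕ) (R : Fin (2 ^ pp.n) → Fin pp.Q) (a : Fin (pp.n + 1) → Fin pp.Q) (x : Fin pp.n → Bool) : ℕ :=
  (R (pp.idx (pp.mask j x))).val * pp.prodFrom j (pp.natKey a) x

/-- The `2ⁿ`-bit table of the hashed `j`-th hybrid. [cite: NaorReingold2004, proof of Thm. 4.1 (p. 250)] -/
def hybTable (j : ℕ) (ω : pp.HΩ) : Fin (2 ^ pp.n) → Bool :=
  fun t => pp.hashBit ω.2.2 (pp.gpow (pp.hybExp j ω.1 ω.2.1 (pp.idx.symm t)))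

/-- The table of the hashed Naor–Reingold function with key exponents `a ∈ ℤ_Q^{n+1}` and hash key
`r`: entry `x` is `⟨r, bin(g^{a₀ ∏_{xᵢ=1} a_{i+1}})⟩`. [cite: NaorReingold2004, Construction 4.1–4.2 (pp. 245–246)] -/
def keyTable (a : Fin (pp.n + 1) → Fin pp.Q) (r : Fin pp.m → Bool) : Fin (2 ^ pp.n) → Bool :=
  fun t => pp.hashBit r (nrFun pp.P pp.g (pp.natKey a) (pp.idx.symm t))

variable {pp}

/-- **Level `0` is the construction** with key `(R(0ⁿ), a₁, …, aₙ)`. [cite: NaorReingold2004, proof of Thm. 4.1 (p. 251: "Pr[D = 1 | J = 1] = Pr[M^{f} = 1]")] -/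
theorem hybExp_zero (R : Fin (2 ^ pp.n) → Fin pp.Q) (a : Fin (pp.n + 1) → Fin pp.Q) (x : Fin pp.n → Bool) :
    pp.hybExp 0 R a x =
      (R (pp.idx fun _ => false)).val * ∏ i : Fin pp.n, (if x i then (a i.succ).val else 1) := by
  simp only [hybExp, mask_zero, prodFrom_zero, natKey]

/-- Level `0` as a Naor–Reingold value: `g^{hybExp 0} = f_{P,Q,g,(R 0ⁿ, a₁..aₙ)}(x)`. [cite: NaorReingold2004, Construction 4.1 (p. 245)] -/
theorem gpow_hybExp_zero (R : Fin (2 ^ pp.n) → Fin pp.Q) (a : Fin (pp.n + 1) → Fin pp.Q) (x : Fin pp.n → Bool) :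
    pp.gpow (pp.hybExp 0 R a x) =
      nrFun pp.P pp.g (pp.natKey (Fin.cons (R (pp.idx fun _ => false)) (Fin.tail a))) x := by
  rw [hybExp_zero, gpow, nrFun]
  rfl

/-- **Level `n` is a uniformly random function**: the exponent is `R(x)`. [cite: NaorReingold2004, proof of Thm. 4.1 (p. 251: "Pr[D = 1 | J = n] = Pr[M^{R} = 1]")] -/
theorem hybExp_n (R : Fin (2 ^ pp.n) → Fin pp.Q) (a : Fin (pp.n + 1) → Fin pp.Q) (x : Fin pp.n → Bool) :
    pp.hybExp pp.n R a x = (R (pp.idx x)).val := by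
  simp [hybExp, mask_n, prodFrom_n]

/-- The level-`0` table is the key table of `(R 0ⁿ, a₁, …, aₙ)`. [cite: NaorReingold2004, proof of Thm. 4.1 (p. 251)] -/
theorem hybTable_zero (ω : pp.HΩ) :
    pp.hybTable 0 ω = pp.keyTable (Fin.cons (ω.1 (pp.idx fun _ => false)) (Fin.tail ω.2.1)) ω.2.2 := by
  funext t
  simp only [hybTable, keyTable, gpow_hybExp_zero]

/-- The level-`n` table is the hashed table of the random function `R`. [cite: NaorReingold2004, proof of Thm. 4.1 (p. 251)] -/
theorem hybTable_n (ω : pp.HΩ) : pp.hybTable pp.n ω = fun t => pp.hashBit ω.2.2 (pp.gpow (ω.1 t).val) := by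
  funext t
  simp only [hybTable, hybExp_n, Equiv.apply_symm_apply]

/-! ### The sub-hybrids of one level: coupling `R(u1) := R(u0) · a_{j+1}` prefix by prefix -/

variable (pp)

/-- The coupled random function of step `τ` at level `j`: at a length-`(j+1)` prefix `y` with
`y_j = 1` whose truncation `y[j ↦ 0]` is among the first `τ` strings of the enumeration, read
`R(y[j ↦ 0]) · α` (a Diffie–Hellman value with the common secret `α = a_{j+1}`) instead of the
independent value `R(y)`. [cite: NaorReingold2004, proof of Thm. 4.1 with Lemma 4.4 (pp. 248–251)] -/
def couple (j : Fin pp.n) (τ : ℕ) (R : Fin (2 ^ pp.n) → Fin pp.Q) (α : ℕ) (y : Fin pp.n → Bool) : ℕ :=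
  if y j = true ∧ (pp.idx (Function.update y j false)).val < τ
  then (R (pp.idx (Function.update y j false))).val * α else (R (pp.idx y)).val

/-- The exponent of the sub-hybrid `(j, τ)` at `x`. [cite: NaorReingold2004, proof of Thm. 4.1 (pp. 250–251)] -/
def subExp (j : Fin pp.n) (τ : ℕ) (R : Fin (2 ^ pp.n) → Fin pp.Q) (a : Fin (pp.n + 1) → Fin pp.Q)
    (x : Fin pp.n → Bool) : ℕ :=
  pp.couple j τ R (a j.succ).val (pp.mask (j.val + 1) x) * pp.prodFrom (j.val + 1) (pp.natKey a) x

/-- The `2ⁿ`-bit table of the hashed sub-hybrid `(j, τ)`. [cite: NaorReingold2004, proof of Thm. 4.1 (pp. 250–251)] -/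
def subTable (j : Fin pp.n) (τ : ℕ) (ω : pp.HΩ) : Fin (2 ^ pp.n) → Bool :=
  fun t => pp.hashBit ω.2.2 (pp.gpow (pp.subExp j τ ω.1 ω.2.1 (pp.idx.symm t)))

variable {pp}

/-- **`τ = 0`: nothing coupled, the sub-hybrid is level `j + 1`.** [cite: NaorReingold2004, proof of Thm. 4.1 (p. 251)] -/
theorem subExp_zero (j : Fin pp.n) (R : Fin (2 ^ pp.n) → Fin pp.Q) (a : Fin (pp.n + 1) → Fin pp.Q)
    (x : Fin pp.n → Bool) : pp.subExp j 0 R a x = pp.hybExp (j.val + 1) R a x := by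
  simp [subExp, couple, hybExp]

/-- **`τ = 2ⁿ`: everything coupled, the sub-hybrid is level `j`.** [cite: NaorReingold2004, proof of Thm. 4.1 (p. 251: "Pr[D(IR) = 1 | J = j] = Pr[D(IPR) = 1 | J = j+1]")] -/
theorem subExp_two_pow (j : Fin pp.n) (R : Fin (2 ^ pp.n) → Fin pp.Q) (a : Fin (pp.n + 1) → Fin pp.Q)
    (x : Fin pp.n → Bool) : pp.subExp j (2 ^ pp.n) R a x = pp.hybExp j.val R a x := by
  simp only [subExp, couple, hybExp, Fin.isLt, and_true, mask_succ_apply_self, update_mask_succ_false]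
  rw [prodFrom_eq_mul_succ j (pp.natKey a) x]
  cases hx : x j
  · simp [mask_succ_of_false hx]
  · simp only [if_true, natKey]
    ring

/-- The `τ = 0` sub-hybrid table is the level-`(j+1)` table. [cite: NaorReingold2004, proof of Thm. 4.1 (p. 251)] -/
theorem subTable_zero (j : Fin pp.n) (ω : pp.HΩ) : pp.subTable j 0 ω = pp.hybTable (j.val + 1) ω := by
  funext t; simp only [subTable, hybTable, subExp_zero]

/-- The `τ = 2ⁿ` sub-hybrid table is the level-`j` table. [cite: NaorReingold2004, proof of Thm. 4.1 (p. 251)] -/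
theorem subTable_two_pow (j : Fin pp.n) (ω : pp.HΩ) : pp.subTable j (2 ^ pp.n) ω = pp.hybTable j.val ω := by
  funext t; simp only [subTable, hybTable, subExp_two_pow]

/-! ### One step `τ → τ + 1`: what changes -/

/-- **Inactive steps**: if the `τ`-th string `u` of the enumeration is not a length-`j` prefix
(`mask j u ≠ u`), the sub-hybrids `τ` and `τ + 1` coincide. [folklore] -/
theorem subExp_succ_of_inactive (j : Fin pp.n) {τ : ℕ} (hτ : τ < 2 ^ pp.n)
    (hu : pp.mask j.val (pp.idx.symm ⟨τ, hτ⟩) ≠ pp.idx.symm ⟨τ, hτ⟩)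
    (R : Fin (2 ^ pp.n) → Fin pp.Q) (a : Fin (pp.n + 1) → Fin pp.Q) (x : Fin pp.n → Bool) :
    pp.subExp j (τ + 1) R a x = pp.subExp j τ R a x := by
  simp only [subExp, couple, update_mask_succ_false]
  have hne : (pp.idx (pp.mask j.val x)).val ≠ τ := by
    intro h
    apply hu
    have : pp.idx (pp.mask j.val x) = ⟨τ, hτ⟩ := Fin.ext h
    rw [← this, Equiv.symm_apply_apply]
    exact mask_mask le_rfl x
  have hiff : (pp.idx (pp.mask j.val x)).val < τ + 1 ↔ (pp.idx (pp.mask j.val x)).val < τ := by omega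
  simp only [hiff]

/-- At an input `x` with prefix `u` and `x_j = 1`: sub-hybrid `τ + 1` (with `τ` the index of `u`)
reads the Diffie–Hellman exponent `R(u) · a_{j+1}`, sub-hybrid `τ` reads the fresh value
`R(u[j ↦ 1])`. [cite: NaorReingold2004, proof of Thm. 4.1 (p. 250, the answers `(g^{c̃})^{∏}` vs `(g^{b})^{a ∏}`)] -/
theorem subExp_at_prefix_true (j : Fin pp.n) {τ : ℕ} (hτ : τ < 2 ^ pp.n) {u x : Fin pp.n → Bool}
    (hu : pp.idx.symm ⟨τ, hτ⟩ = u) (hx : pp.mask j.val x = u) (hxj : x j = true)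
    (R : Fin (2 ^ pp.n) → Fin pp.Q) (a : Fin (pp.n + 1) → Fin pp.Q) :
    pp.subExp j (τ + 1) R a x = (R (pp.idx u)).val * (a j.succ).val * pp.prodFrom (j.val + 1) (pp.natKey a) x ∧
    pp.subExp j τ R a x = (R (pp.idx (Function.update u j true))).val * pp.prodFrom (j.val + 1) (pp.natKey a) x := by
  have hidx : pp.idx u = ⟨τ, hτ⟩ := by rw [← hu, Equiv.apply_symm_apply]
  refine ⟨?_, ?_⟩
  · simp only [subExp, couple, update_mask_succ_false, mask_succ_apply_self, hxj, hx, hidx, true_and,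
      lt_add_iff_pos_right, zero_lt_one, if_true]
  · simp only [subExp, couple, update_mask_succ_false, mask_succ_apply_self, hxj, hx, hidx, true_and,
      lt_self_iff_false, if_false]
    rw [← update_mask_true hxj, hx]

/-- At an input `x` with prefix `u` and `x_j = 0`: both sub-hybrids read `R(u)`. [cite: NaorReingold2004, proof of Thm. 4.1 (p. 250, the answers `(g^{b})^{∏}`)] -/
theorem subExp_at_prefix_false (j : Fin pp.n) (τ' : ℕ) {u x : Fin pp.n → Bool}
    (hx : pp.mask j.val x = u) (hxj : x j = false)
    (R : Fin (2 ^ pp.n) → Fin pp.Q) (a : Fin (pp.n + 1) → Fin pp.Q) :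
    pp.subExp j τ' R a x = (R (pp.idx u)).val * pp.prodFrom (j.val + 1) (pp.natKey a) x := by
  simp only [subExp, couple, mask_succ_apply_self, hxj, mask_succ_of_false hxj, hx]
  simp

/-- At an input `x` off the prefix `u` with `x_j = 1` and an already coupled prefix (index `< τ`):
both sub-hybrids read `R(mask j x) · a_{j+1}`, and `mask j x ∉ {u, u[j ↦ 1]}`. [cite: NaorReingold2004, proof of Lemma 4.4 (p. 249: the other Diffie–Hellman pairs share `g^a`)] -/
theorem subExp_of_coupled (j : Fin pp.n) {τ : ℕ} (hτ : τ < 2 ^ pp.n) {u x : Fin pp.n → Bool}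
    (hu : pp.idx.symm ⟨τ, hτ⟩ = u) (hx : pp.mask j.val x ≠ u) (hxj : x j = true)
    (hlt : (pp.idx (pp.mask j.val x)).val < τ) {τ' : ℕ} (hτ' : τ' = τ ∨ τ' = τ + 1)
    (R : Fin (2 ^ pp.n) → Fin pp.Q) (a : Fin (pp.n + 1) → Fin pp.Q) :
    pp.subExp j τ' R a x = (R (pp.idx (pp.mask j.val x))).val * (a j.succ).val * pp.prodFrom (j.val + 1) (pp.natKey a) x ∧
    pp.idx (pp.mask j.val x) ≠ pp.idx u ∧ pp.idx (pp.mask j.val x) ≠ pp.idx (Function.update u j true) := by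
  have hlt' : (pp.idx (pp.mask j.val x)).val < τ' := by rcases hτ' with rfl | rfl <;> omega
  refine ⟨?_, fun h => hx (pp.idx.injective h), fun h => ?_⟩
  · simp only [subExp, couple, update_mask_succ_false, mask_succ_apply_self, hxj, hlt', and_self, if_true]
  · have := congrFun (pp.idx.injective h) j
    simp [mask_apply_self] at this

/-- At an input `x` off the prefix `u` that is not coupled: both sub-hybrids read the fresh value
`R(mask (j+1) x)`, and `mask (j+1) x ∉ {u, u[j ↦ 1]}` when `u` is a length-`j` prefix. [folklore] -/
theorem subExp_of_free (j : Fin pp.n) {τ : ℕ} (hτ : τ < 2 ^ pp.n) {u x : Fin pp.n → Bool}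
    (hu : pp.idx.symm ⟨τ, hτ⟩ = u) (huj : pp.mask j.val u = u) (hx : pp.mask j.val x ≠ u)
    (hnc : ¬ (x j = true ∧ (pp.idx (pp.mask j.val x)).val < τ)) {τ' : ℕ} (hτ' : τ' = τ ∨ τ' = τ + 1)
    (R : Fin (2 ^ pp.n) → Fin pp.Q) (a : Fin (pp.n + 1) → Fin pp.Q) :
    pp.subExp j τ' R a x = (R (pp.idx (pp.mask (j.val + 1) x))).val * pp.prodFrom (j.val + 1) (pp.natKey a) x ∧
    pp.idx (pp.mask (j.val + 1) x) ≠ pp.idx u ∧ pp.idx (pp.mask (j.val + 1) x) ≠ pp.idx (Function.update u j true) := by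
  have hne : (pp.idx (pp.mask j.val x)).val ≠ τ := by
    intro h
    apply hx
    have : pp.idx (pp.mask j.val x) = ⟨τ, hτ⟩ := Fin.ext h
    rw [← hu, ← this, Equiv.symm_apply_apply]
  have hnc' : ¬ (x j = true ∧ (pp.idx (pp.mask j.val x)).val < τ') := by
    rintro ⟨h1, h2⟩
    exact hnc ⟨h1, by rcases hτ' with rfl | rfl <;> omega⟩
  refine ⟨?_, fun h => ?_, fun h => ?_⟩
  · simp only [subExp, couple, update_mask_succ_false, mask_succ_apply_self, hnc', if_false]
  · apply hx
    have h' := pp.idx.injective h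
    rw [← mask_mask (Nat.le_succ j.val) x, h', huj]
  · apply hx
    have h' := congrArg (pp.mask j.val) (pp.idx.injective h)
    rw [mask_mask (Nat.le_succ j.val)] at h'
    rw [h']
    have : pp.mask j.val (Function.update u j true) = pp.mask j.val u := by
      funext i
      by_cases hi : i = j
      · subst hi; simp [mask]
      · simp [mask, Function.update_of_ne hi]
    rw [this, huj]

end Params

end NaorReingold

end Literature.Computability.Cryptography

end
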